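import Summits.BirchSwinnertonDyer.BirchSwinnertonDyer.Theorems.EdixhovenFibreFiveSevenStarredOptimalManinUnitFiveSevenAssemblyAt
import HarnessLib
/-!
# F″ programme — the assembly socket AT ONE ISOGENY CLASS, fed by the PRINT-FAITHFUL P1
# `exists_member_sl2ZetaElement_neron_values_bar` (value-law factor `(c² − c·χ̄(c))(d² − d·χ̄(d))`)
# (route `EdixhovenFibreFiveSeven`, crux K★ stmt-BirchSwinnertonDyer-22226, line `kato-lever`; seat `bsd-line-edix-p4` g14;
# `--supports` 22226, helper; erratum DD-UE-1 of the audit sheet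
# `pub/bsd-cited/sheets/D-AUDIT-r02-UE-Kato2004-SL2NeronValues-813-97-66-136.md`)

HONEST FRAMING. TOOL theorem only (no definition, no named fact, no `sorry`, no local instance); nothing is closed or
booked; BSD is not proved by any of this.

WHY. The opener `KatoAssemblySocketAt.katoNeronBody_of_sl2NeronValues_of_isDeRhamAt` (this namespace, file
`…AssemblyAt.lean`) reads the value law of the cite-only fact P1 `exists_member_sl2ZetaElement_neron_values`, whose
factor `(c² − c·χ(c))(d² − d·χ̄(d))` misreads Kato's print `(c² − c·χ̄(c))(d² − d·χ̄(d))` (Thm 6.6 (1) p. 163 = Thm 5.6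
p. 157, both characters barred; audit F-UE-1). The print-faithful statement is `exists_member_sl2ZetaElement_neron_values_bar`
(same file, appended). The socket `KatoAssemblySocket.exists_isIntegral_of_forall_valueLaw` is bar-agnostic
(`μ ∈ {χ(c), χ̄(c)}`, `ν ∈ {χ(d), χ̄(d)}`), so the opener's proof goes through VERBATIM with the law read at `χ̄ = χ⁻¹` and
`(μ, ν) = (χ(c), χ(d))` (`(χ̄(a))⁻¹ = χ(a)`, `KatoAssemblySocket.inv_inv_apply`) in place of `(χ̄(c), χ(d))`.

* ★★ `katoNeronBody_of_sl2NeronValuesBar_of_isDeRhamAt` — the body of F″ at `(V, p)` ⟸ P1-bar ∧ hT₂ ∧ hP ∧ hDRV, the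
  statement of `katoNeronBody_of_sl2NeronValues_of_isDeRhamAt` with `hP1 : exists_member_sl2ZetaElement_neron_values_bar`.

References: [Kato2004Asterisque] (8.1.3) p. 180, §8.3 p. 181, Thm. 9.7 p. 189, Thm. 6.6 (1) p. 163, Thm. 5.6 p. 157, Thm. 13.6 p. 227;
[Kato1993LNM1553] Ch. II Prop. 1.2.3, Ex. 1.3.5, Thm. 1.4.1; [BlochKato1990] Prop. 3.8, Ex. 3.11; [KimNakamura2020] Cor. 2.4;
[GreenbergVatsal2000] §3 Remark 3.4; [AtkinLehner1970] Thm. 3; [FontaineAsterisque223III] Exp. III §1.5.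
-/

set_option autoImplicit false
-- the Theorems namespace of a single-conjunct summit repeats the summit name by design (D-0017)
set_option linter.dupNamespace false

noncomputable section

namespace Summit.BirchSwinnertonDyer.BirchSwinnertonDyer.Theorems.KatoAssemblySocketAt

open scoped MatrixGroups ModularForm Classical NumberField TensorProduct
open Complex CongruenceSubgroup WeierstrassCurve IsDedekindDomain NumberField
open Field ValuativeRel
open Literature.NumberTheory.GaloisRepresentations
open Literature.NumberTheory.GaloisRepresentations.IsNonarchimedeanLocalField
open Literature.NumberTheory.PAdicHodge
open Literature.NumberTheory.EllipticCurves Literature.NumberTheory.EllipticCurves.ModularForms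
open Literature.NumberTheory.EllipticCurves.Kato2004 Literature.NumberTheory.EllipticCurves.Kato2004.EulerSystemValues
open Summit.BirchSwinnertonDyer.BirchSwinnertonDyer.Theorems.SemiLocalDescent
open Summit.BirchSwinnertonDyer.BirchSwinnertonDyer.Theorems.KatoNeronIsogenyTransport
open Summit.BirchSwinnertonDyer.BirchSwinnertonDyer.Theorems.KatoAssemblySocket
open Summit.BirchSwinnertonDyer.BirchSwinnertonDyer.Theorems.KatoCarayolFree
open Summit.BirchSwinnertonDyer.BirchSwinnertonDyer.Theorems.StarredOptimalManinUnitFiveSevenValueExit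
open Summit.BirchSwinnertonDyer.BirchSwinnertonDyer.Theorems.KimAtThreeDeepLowerExpStarOmega
open Summit.BirchSwinnertonDyer.BirchSwinnertonDyer.Theorems.KimAtThreeDeepLowerExpStarOmegaPlace
open Summit.BirchSwinnertonDyer.BirchSwinnertonDyer.Theorems.KimAtThreeDeepUpperTowerLattice
  (fact_natCast_mem_primesEquiv_symm)
open Rat.HeightOneSpectrum

set_option backward.isDefEq.respectTransparency false in
set_option maxHeartbeats 1600000 in
/-- ★★ **F″ AT ONE ISOGENY CLASS ⟸ P1-bar ∧ (S5b-tower) ∧ Prop. 1.2.3 ∧ «`V_pV|_{Γ_{ℚ_p}}` is de Rham» for THIS `V`.**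
The statement of `katoNeronBody_of_sl2NeronValues_of_isDeRhamAt` with the print-faithful cite-only fact
`exists_member_sl2ZetaElement_neron_values_bar` (value-law factor `(c² − c·χ̄(c))(d² − d·χ̄(d))`, Kato Thm 6.6 (1)) in
place of `exists_member_sl2ZetaElement_neron_values`. Proof = that opener's proof verbatim (P1-bar at `(V, p)`: Kato's
member `W′ ∼ V`, the Néron-pinned line datum, the Manin-symbol coordinate, the level data; P6 `hyps_of_isIsogenous`;
`hDRV` moved to `W′` by `isDeRham_restrictedRationalTateRep_of_isIsogenous`; (INT) by
`SemiLocalIntegralityAt.semilocal_mem_adicCompletionIntegers_of_pin_of_semi_of_isDeRhamAt`; the member value law; the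
value exit; P6 `body_of_isIsogenous`), except that the value law, read at `χ̄ = χ⁻¹`, is handed to the bar-agnostic
socket shape with `(μ, ν) = (χ(c), χ(d))` (`(χ̄(a))⁻¹ = χ(a)`). CONDITIONAL on the displayed facts; nothing is closed.
[cite: Kato2004Asterisque, (8.1.3) (p. 180), §8.3 (p. 181), Thm. 9.7 (p. 189), Thm. 6.6 (1) (p. 163), Thm. 5.6 (p. 157), Thm. 13.6 (p. 227)]
[cite: Kato1993LNM1553, Ch. II Prop. 1.2.3, Ex. 1.3.5, Thm. 1.4.1 (3)–(4)] [cite: BlochKato1990, Prop. 3.8 and Example 3.11]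
[cite: KimNakamura2020, Cor. 2.4] [cite: GreenbergVatsal2000, §3 Remark 3.4] [cite: AtkinLehner1970, Thm. 3] -/
theorem katoNeronBody_of_sl2NeronValuesBar_of_isDeRhamAt
    (hT₂ : Literature.NumberTheory.PAdicHodge.exists_smul_range_expStarCoord_tower_iff_trace_log)
    (hP : Literature.NumberTheory.PAdicHodge.cupLogInjective_and_hasDualExp_of_isDeRham)
    (hP1 : exists_member_sl2ZetaElement_neron_values_bar)
    (V : WeierstrassCurve ℚ) [V.IsElliptic] [V.IsGloballyMinimal] (p : ℕ) [hp : Fact p.Prime]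
    (hDRV : ∀ (v : HeightOneSpectrum (𝓞 ℚ)), ((p : ℕ) : 𝓞 ℚ) ∈ v.asIdeal →
      ∀ [CharZero (v.adicCompletion ℚ)] [Fact (¬ IsUnit (p : integerC (v.adicCompletion ℚ)))]
        [IsAdicComplete (Ideal.span {(p : integerC (v.adicCompletion ℚ))}) (integerC (v.adicCompletion ℚ))]
        (hp' : valuation (v.adicCompletion ℚ) p < 1) [Algebra ℚ_[p] (v.adicCompletion ℚ)],
        GaloisRep.IsDeRham (bdRPeriodRingData (F := v.adicCompletion ℚ) (p := p) hp')
          (restrictedRationalTateRep V (v.adicCompletion ℚ) p))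
    {N : ℕ} [NeZero N] (f : CuspForm (Gamma0 N) 2) (hf : IsNewformOf V f) (hp5 : 5 ≤ p)
    (hgood : ¬ V.HasGoodReductionAtPrime p) (hmult : ¬ V.HasMultiplicativeReductionAtPrime p)
    (hirr : V.HasIrreducibleModPGaloisRep p) (m : ℕ) [NeZero m] (hm : m.Coprime (p * N))
    (htors : 7 < p ∨ (Nat.Coprime (orderOf (p : ZMod m)) (p - 1) ∧
      ∀ P : (V.baseChange ℚ_[p]).toAffine.Point, p • P = 0 → P = 0))
    (χ : DirichletCharacter ℂ m) (hχ : χ.IsPrimitive) (hχ1 : χ ≠ 1) (hord : ¬ p ∣ orderOf χ)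
    (ϖ : ℚ) (r : ℂ) :
    (χ.Even → (ϖ : ℝ) * V.realPeriodRat = plusPeriod f →
        (∏ ℓ ∈ N.primeFactors with ¬ ℓ ^ 2 ∣ N,
            (((ℓ : ℂ) - (V.LFunction ℓ : ℂ) * χ (ℓ : ZMod m)) *
              ((ℓ : ℂ) - (V.LFunction ℓ : ℂ) * (χ (ℓ : ZMod m))⁻¹))) *
            twistedSymbolSum f χ = r * (plusPeriod f : ℂ) →
        ∃ s : ℕ, ¬ p ∣ s ∧ IsIntegral ℤ ((s : ℂ) * ϖ * r)) ∧
      (χ.Odd → (ϖ : ℝ) * V.imaginaryPeriodRat = minusPeriod f →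
        (∏ ℓ ∈ N.primeFactors with ¬ ℓ ^ 2 ∣ N,
            (((ℓ : ℂ) - (V.LFunction ℓ : ℂ) * χ (ℓ : ZMod m)) *
              ((ℓ : ℂ) - (V.LFunction ℓ : ℂ) * (χ (ℓ : ZMod m))⁻¹))) *
            twistedSymbolSum f χ = r * (minusPeriod f : ℂ) * Complex.I →
        ∃ s : ℕ, ¬ p ∣ s ∧ IsIntegral ℤ ((s : ℂ) * ϖ * r)) := by
  -- P1-bar at `(V, p)`: Kato's member `W′ ∼ V`, the Néron-pinned line datum `d₀`, the coordinate `n`, the level data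
  obtain ⟨W', hW'E, hW'M, hiso, hW'⟩ := hP1 V p
  letI : ContinuousSMul ℤ_[p] (W'.tateModule p) := TateModule.continuousSMul_padicInt
  haveI : Module.Free ℤ_[p] (W'.tateModule p) := W'.module_free_tateModule_holds p
  haveI : Module.Finite ℤ_[p] (W'.tateModule p) := W'.module_finite_tateModule_holds p
  obtain ⟨d₀, hPIN, n, hn, hm'⟩ := hW' f hf
  obtain ⟨ι, Λ, hSEMI, hval⟩ := hm' m
  obtain ⟨Ψ, hΨ⟩ := Literature.NumberTheory.AdelicBaseChange.exists_padicTensorAlgEquiv (CyclotomicField m ℚ) p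
  -- the member's own copy of F″'s hypotheses (P6 `hyps_of_isIsogenous`)
  obtain ⟨hfW, hgoodW, hmultW, hirrW, htorsW⟩ := hyps_of_isIsogenous hiso hf hgood hmult hirr htors
  have hp2 : p ≠ 2 := by omega
  -- de Rham at `V` in the `ℚ_v`-keys of the Pin file (`v = (p)`): the hypothesis at the file-local structures of
  -- `KimAtThreeDeepLowerExpStarOmegaPlace` (plain definitions, passed explicitly — no instance is registered here) …
  have h0 := @hDRV ((primesEquiv (R := 𝓞 ℚ)).symm ⟨p, hp.out⟩) (fact_natCast_mem_primesEquiv_symm p).out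
    (charZero_place _) (@fact_not_isUnit_place p _ (fact_natCast_mem_primesEquiv_symm p))
    (@isAdicComplete_place p _ _ (fact_natCast_mem_primesEquiv_symm p))
    (@valuation_place_lt_one p _ (fact_natCast_mem_primesEquiv_symm p))
    (@padicAlgebraPlace p _ _ (fact_natCast_mem_primesEquiv_symm p))
  -- … read for the tree's `ℚ`-algebra structure `Place.instAlgebraCompletion` on `ℚ_v` (any two `ℚ`-algebra structures
  -- on a ring coincide, so the restricted representation does not depend on the choice) …
  have hrep : ∀ (i₁ i₂ : Algebra ℚ (((primesEquiv (R := 𝓞 ℚ)).symm ⟨p, hp.out⟩).adicCompletion ℚ)),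
      @restrictedRationalTateRep ℚ _ V _ _ i₁ p _ _ = @restrictedRationalTateRep ℚ _ V _ _ i₂ p _ _ :=
    fun i₁ i₂ ↦ by rw [Subsingleton.elim i₁ i₂]
  have h1 := (hrep (@DivisionRing.toRatAlgebra _ _ (charZero_place _))
    (Place.instAlgebraCompletion (Sum.inr ((primesEquiv (R := 𝓞 ℚ)).symm ⟨p, hp.out⟩) : Place ℚ))) ▸ h0
  -- … and moved to the member `W′` along `V ∼ W′` (`DeRhamEllipticIsogeny`)
  have hDRW := @isDeRham_restrictedRationalTateRep_of_isIsogenous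
    (Place.Completion (Sum.inr ((primesEquiv (R := 𝓞 ℚ)).symm ⟨p, hp.out⟩) : Place ℚ)) _
    (valuativeRelPlace _) (topologicalSpacePlace _) (isNonarchimedeanLocalField_place _) (charZero_place _) p _
    (@fact_not_isUnit_place p _ (fact_natCast_mem_primesEquiv_symm p))
    (@isAdicComplete_place p _ _ (fact_natCast_mem_primesEquiv_symm p))
    (@valuation_place_lt_one p _ (fact_natCast_mem_primesEquiv_symm p))
    (@padicAlgebraPlace p _ _ (fact_natCast_mem_primesEquiv_symm p)) ℚ _ _
    (Place.instAlgebraCompletion _) V W' _ hW'E hiso h1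
  -- (INT): every semi-local value `Ψ (Λ y) w` is a `w`-adic integer — P4-coh PER CURVE at the member
  have hint : ∀ (y : H1 (tateRep W' p) (rootsOfUnityFixer ℚ m))
      (w : ((primesEquiv (R := 𝓞 ℚ)).symm ⟨p, hp.out⟩).Extension (𝓞 (CyclotomicField m ℚ))),
      Ψ (Λ y) w ∈ w.1.adicCompletionIntegers (CyclotomicField m ℚ) := fun y w ↦
    SemiLocalIntegralityAt.semilocal_mem_adicCompletionIntegers_of_pin_of_semi_of_isDeRhamAt p hT₂ hP W' hDRW hp5
      ⟨hgoodW, hmultW⟩ d₀ hPIN m (not_dvd_of_coprime_mul hm) htorsW Λ Ψ (hSEMI Ψ hΨ) y w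
  -- the member value law with `p`-integral character sum (body of `memberValueLaw_of_integralSL2NeronValues`)
  have hVL : ∀ (L : ℂ → ℂ), EulerSystemValues.IsDepletedTwistedL f m (p * N) χ⁻¹ L →
      ∀ c d : ℕ,
      (1 < c ∧ c ≡ 1 [MOD N] ∧ c ≡ 1 [MOD p] ∧ (p : ℤ) ∣ (c : ℤ) - 1 ∧ c.Coprime (6 * (m * (p * N))) ∧
        IsUnit (c : ZMod m) ∧ χ (c : ZMod m) ≠ 1) →
      (1 < d ∧ d ≡ 1 [MOD N] ∧ d ≡ 1 [MOD p] ∧ (p : ℤ) ∣ (d : ℤ) - 1 ∧ d.Coprime (6 * (m * (p * N))) ∧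
        IsUnit (d : ZMod m) ∧ χ (d : ZMod m) ≠ 1) →
      ∃ (q : ℚ) (y μ ν : ℂ), ¬ (p : ℤ) ∣ q.num ∧ (∃ s : ℕ, ¬ p ∣ s ∧ IsIntegral ℤ ((s : ℂ) * y)) ∧
        (μ = χ (c : ZMod m) ∨ μ = χ⁻¹ (c : ZMod m)) ∧ (ν = χ (d : ZMod m) ∨ ν = χ⁻¹ (d : ZMod m)) ∧
        (χ.Even → y = ((c : ℂ) ^ 2 - (c : ℂ) * μ) * ((d : ℂ) ^ 2 - (d : ℂ) * ν) * (q : ℂ) *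
          (L 1 / (W'.realPeriodRat : ℂ))) ∧
        (χ.Odd → y = ((c : ℂ) ^ 2 - (c : ℂ) * μ) * ((d : ℂ) ^ 2 - (d : ℂ) * ν) * (q : ℂ) *
          (L 1 / (Complex.I * (W'.imaginaryPeriodRat : ℂ)))) := by
    intro L hL c d hc hd
    obtain ⟨-, hcN, -, -, hccop, -, -⟩ := hc
    obtain ⟨-, hdN, -, -, hdcop, -, -⟩ := hd
    -- Kato's guards for `(c, d)` in the P1 text's `ℤ`-currency
    have hcZ : (c : ℤ) ≡ 1 [ZMOD (N : ℤ)] := intModEq_one_of_natModEq_one hcN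
    have hdZ : (d : ℤ) ≡ 1 [ZMOD (N : ℤ)] := intModEq_one_of_natModEq_one hdN
    have hgcd : Int.gcd ((c : ℤ) * (d : ℤ)) (6 * (p : ℤ) * (m : ℤ)) = 1 := int_gcd_mul_eq_one_of_coprime hccop hdcop
    -- the parity of `χ` decides the sign `b` at which the Manin-symbol coordinate is taken
    by_cases hev : χ.Even
    · obtain ⟨ξ, hnξ0, hnξv⟩ := hn hp2 true
      obtain ⟨z, x, hΛz, hlaw⟩ := hval (c : ℤ) (d : ℤ) ξ hcZ hdZ hgcd
      obtain ⟨hlawE, -⟩ := hlaw χ⁻¹ L hL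
      have hE : χ⁻¹ (-1) = 1 := (inv_apply_neg_one_eq_one_iff χ).2 hev
      have hlawE' := hlawE hE
      refine ⟨n ξ true, charSum m ι χ⁻¹ x, χ (c : ZMod m), χ (d : ZMod m),
        not_dvd_num_of_padicValRat_eq_zero hnξ0 hnξv,
        exists_not_dvd_isIntegral_charSum_of_forall_semilocal_mem m p Ψ hΨ x (Λ z) hΛz (hint z) ι χ⁻¹,
        Or.inl rfl, Or.inl rfl, fun _ ↦ ?_, fun hod ↦ ?_⟩
      · rw [hlawE']
        simp only [inv_inv_apply]
        push_cast
        ring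
      · exfalso
        have h1 : χ (-1) = 1 := hev
        have h2 : χ (-1) = -1 := hod
        rw [h1] at h2
        norm_num at h2
    · obtain ⟨ξ, hnξ0, hnξv⟩ := hn hp2 false
      obtain ⟨z, x, hΛz, hlaw⟩ := hval (c : ℤ) (d : ℤ) ξ hcZ hdZ hgcd
      obtain ⟨-, hlawO⟩ := hlaw χ⁻¹ L hL
      refine ⟨n ξ false, charSum m ι χ⁻¹ x, χ (c : ZMod m), χ (d : ZMod m),
        not_dvd_num_of_padicValRat_eq_zero hnξ0 hnξv,
        exists_not_dvd_isIntegral_charSum_of_forall_semilocal_mem m p Ψ hΨ x (Λ z) hΛz (hint z) ι χ⁻¹,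
        Or.inl rfl, Or.inl rfl, fun hev' ↦ absurd hev' hev, fun hod ↦ ?_⟩
      have hO : χ⁻¹ (-1) = -1 := (inv_apply_neg_one_eq_neg_one_iff χ).2 hod
      rw [hlawO hO]
      simp only [inv_inv_apply]
      push_cast
      ring
  -- the value exit at the member (body of `kato_neron_five_le_of_memberValueLaw'`): level facts from the Fourier
  -- coefficients, the entire continuation of the `(m·pN)`-inflated series of `χ̄`, the depleted value, NIV ⟹ F″ at `W′`
  have hpN : p ∣ N := dvd_level_of_isNewformOf_of_not_good_of_not_mult W' hfW hgoodW hmultW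
  have hsq := forall_lFunction_eq_zero_of_sq_dvd_level W' hfW
  haveI : NeZero (m * (p * N)) :=
    ⟨mul_ne_zero (NeZero.ne m) (mul_ne_zero (Fact.out : p.Prime).ne_zero (NeZero.ne N))⟩
  obtain ⟨L, hLd, hLs⟩ := exists_differentiable_eq_twistedLSeries_holds f
    (DirichletCharacter.changeLevel (dvd_mul_right m (p * N)) χ⁻¹)
  have hL : EulerSystemValues.IsDepletedTwistedL f m (p * N) χ⁻¹ L := ⟨hLd, hLs⟩
  obtain ⟨heven, hodd⟩ := depletedValueIntegral_of_memberValueLaw W' f hm χ hχ1 hord hVL L hL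
  have hbodyW : ∀ (ϖ : ℚ) (r : ℂ),
      (χ.Even → (ϖ : ℝ) * W'.realPeriodRat = plusPeriod f →
        (∏ ℓ ∈ N.primeFactors with ¬ ℓ ^ 2 ∣ N,
            (((ℓ : ℂ) - (W'.LFunction ℓ : ℂ) * χ (ℓ : ZMod m)) *
              ((ℓ : ℂ) - (W'.LFunction ℓ : ℂ) * (χ (ℓ : ZMod m))⁻¹))) *
            twistedSymbolSum f χ = r * (plusPeriod f : ℂ) →
        ∃ s : ℕ, ¬ p ∣ s ∧ IsIntegral ℤ ((s : ℂ) * ϖ * r)) ∧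
      (χ.Odd → (ϖ : ℝ) * W'.imaginaryPeriodRat = minusPeriod f →
        (∏ ℓ ∈ N.primeFactors with ¬ ℓ ^ 2 ∣ N,
            (((ℓ : ℂ) - (W'.LFunction ℓ : ℂ) * χ (ℓ : ZMod m)) *
              ((ℓ : ℂ) - (W'.LFunction ℓ : ℂ) * (χ (ℓ : ZMod m))⁻¹))) *
            twistedSymbolSum f χ = r * (minusPeriod f : ℂ) * Complex.I →
        ∃ s : ℕ, ¬ p ∣ s ∧ IsIntegral ℤ ((s : ℂ) * ϖ * r)) := fun ϖ₁ r₁ ↦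
    ⟨fun hev hϖ hr ↦ katoNeron_even_of_depletedValue W' hfW hpN hsq hm hχ hL (heven hev) hϖ hr,
      fun hod hϖ hr ↦ katoNeron_odd_of_depletedValue W' hfW hpN hsq hm hχ hL (hodd hod) hϖ hr⟩
  -- P6: back to `V` along the prime-to-`p` isogeny (`V[p]` irreducible)
  exact body_of_isIsogenous hiso hirr hf χ hbodyW ϖ r

end Summit.BirchSwinnertonDyer.BirchSwinnertonDyer.Theorems.KatoAssemblySocketAt

end
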